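import Mathlib
import Literature.Analysis.FluidPDE.LocalHelmholtzSupBound
import Summits.NavierStokesRegularity.NavierStokesRegularity.Theorems.ThreadingFluxCentreJetLocalDriftLaw
import HarnessLib

/-!
# Crux `PoloidalLiouville` (stmt-NavierStokesRegularity-1222, wall W1), crux idea «azimuthal-cartan-test» (ns-idea-15 g10):
# LOCAL `curl curl = ∇ div − Δ` — the vector identities of the tree for fields that are `C²` on a BALL only

Support file (`--supports stmt-NavierStokesRegularity-1222`, helper; cell `ns-wall-extremal`, width hand ns-wall-eng-7 g7, 0 kit).
The tree proves `curl (curl W) = Σᵢ ∂ᵢ(div W) eᵢ − ΔW` (`curl_curl_eq_sum_fderiv_divergence_sub_laplacian`, `LocalHelmholtzSupBound`) and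
`Δu = −curl curl u` (`laplacian_eq_neg_curl_curl`, `LocalBiotSavartCalculus`) for GLOBALLY `C²` (and globally divergence-free) fields.
The explicit witnesses of the card (J♭, K♭) are smooth only off the axis, so this file localises: for `u` of class `C²` on `ball x r`,

* `curl_curl_eq_local` — `curl (curl u) x = Σᵢ ∂ᵢ(div u)(x) eᵢ − Δu(x)`;
* `laplacian_eq_neg_curl_curl_local` — if `div u = 0` on the ball, `Δu(x) = −curl (curl u)(x)`;
* `laplacian_eq_zero_of_div_curl_local` — if `div u = 0` and `curl u = 0` on the ball, `Δu(x) = 0` (harmonic gradients);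
* `laplacian_eq_neg_curl_local` — if `div u = 0` on the ball and `curl u = w` on the ball, `Δu(x) = −curl w (x)`.

Device: a global `C²` representative agreeing with `u` near `x` (ns-wall-eng-7 g5 `CentreJet.exists_contDiff_eventuallyEq_of_ball`, bump
cut-off) and the locality of `fderiv`, `curl`, `div`, `Δ` in the germ.
HONEST FRAME: calculus; closes no crux or sketch Prop; `PoloidalLiouville` (1222) and NS regularity OPEN.
-/

-- the summit and its single sub-problem share the name (CONVENTIONS §1)
set_option linter.dupNamespace false

noncomputable section

namespace Summit.NavierStokesRegularity.NavierStokesRegularity.Theorems.PoloidalLiouville.AzimuthalCartan.LocalCurlCurl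

open Set Function Filter Topology Metric
open scoped ContDiff
open Literature.Analysis.FluidPDE
open Summit.NavierStokesRegularity.NavierStokesRegularity.Theorems.PoloidalLiouville.CentreJet (E3 exists_contDiff_eventuallyEq_of_ball
  eventually_eventuallyEq_of_eventuallyEq)

variable {u : E3 → E3} {x : E3} {r : ℝ}

/-- `curl` is local in the germ. -/
theorem curl_eventuallyEq_of_eventuallyEq {v w : E3 → E3} {x : E3} (h : v =ᶠ[𝓝 x] w) : curl v =ᶠ[𝓝 x] curl w := by
  filter_upwards [eventually_eventuallyEq_of_eventuallyEq h] with z hz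
  rw [curl_eq_curlCLM, curl_eq_curlCLM, hz.fderiv_eq]

/-- `div` is local in the germ. -/
theorem divergence_eventuallyEq_of_eventuallyEq {v w : E3 → E3} {x : E3} (h : v =ᶠ[𝓝 x] w) :
    VectorCalculus.divergence v =ᶠ[𝓝 x] VectorCalculus.divergence w := by
  filter_upwards [eventually_eventuallyEq_of_eventuallyEq h] with z hz
  rw [VectorCalculus.divergence, VectorCalculus.divergence, hz.fderiv_eq]

/-- **Local `curl curl = ∇ div − Δ`**: for `u` of class `C²` on `ball x r`,
`curl (curl u) x = Σᵢ ∂ᵢ(div u)(x) eᵢ − Δu(x)`. -/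
theorem curl_curl_eq_local (hr : 0 < r) (hu : ContDiffOn ℝ 2 u (ball x r)) :
    curl (curl u) x =
      (∑ i, (fderiv ℝ (VectorCalculus.divergence u) x (EuclideanSpace.single (i : Fin 3) (1 : ℝ))) •
        (EuclideanSpace.single (i : Fin 3) (1 : ℝ))) - Laplacian.laplacian u x := by
  obtain ⟨W, hW, hWu⟩ := exists_contDiff_eventuallyEq_of_ball (n := 2) hr hu
  have h := curl_curl_eq_sum_fderiv_divergence_sub_laplacian hW x
  -- transport every term from `W` to `u`
  have hc : curl (curl W) x = curl (curl u) x :=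
    (curl_eventuallyEq_of_eventuallyEq (curl_eventuallyEq_of_eventuallyEq hWu)).eq_of_nhds
  have hd : ∀ i : Fin 3, fderiv ℝ (VectorCalculus.divergence W) x (EuclideanSpace.single i (1 : ℝ)) =
      fderiv ℝ (VectorCalculus.divergence u) x (EuclideanSpace.single i (1 : ℝ)) := fun i => by
    rw [(divergence_eventuallyEq_of_eventuallyEq hWu).fderiv_eq]
  have hl : Laplacian.laplacian W x = Laplacian.laplacian u x := (InnerProductSpace.laplacian_congr_nhds hWu).eq_of_nhds
  rw [hc, hl] at h
  simp only [hd] at h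
  exact h

/-- **Local `Δu = −curl curl u`** for `u` of class `C²` and divergence-free on `ball x r`. -/
theorem laplacian_eq_neg_curl_curl_local (hr : 0 < r) (hu : ContDiffOn ℝ 2 u (ball x r))
    (hdiv : ∀ y ∈ ball x r, VectorCalculus.divergence u y = 0) : Laplacian.laplacian u x = -curl (curl u) x := by
  have h := curl_curl_eq_local hr hu
  have hball : ball x r ∈ 𝓝 x := ball_mem_nhds x hr
  have hd0 : VectorCalculus.divergence u =ᶠ[𝓝 x] fun _ => (0 : ℝ) := by
    filter_upwards [hball] with y hy using hdiv y hy
  have hfd : fderiv ℝ (VectorCalculus.divergence u) x = 0 := by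
    rw [hd0.fderiv_eq]; simp
  simp only [hfd, zero_apply, zero_smul, Finset.sum_const_zero, zero_sub] at h
  rw [h, neg_neg]

/-- **Local `Δu = −curl ω`** when `curl u = ω` on the ball (and `div u = 0` there). -/
theorem laplacian_eq_neg_curl_local (hr : 0 < r) (hu : ContDiffOn ℝ 2 u (ball x r))
    (hdiv : ∀ y ∈ ball x r, VectorCalculus.divergence u y = 0) {w : E3 → E3} (hw : ∀ y ∈ ball x r, curl u y = w y) :
    Laplacian.laplacian u x = -curl w x := by
  rw [laplacian_eq_neg_curl_curl_local hr hu hdiv]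
  have hc : curl u =ᶠ[𝓝 x] w := by
    filter_upwards [ball_mem_nhds x hr] with y hy using hw y hy
  rw [(curl_eventuallyEq_of_eventuallyEq hc).eq_of_nhds]

/-- **Harmonic gradients, locally**: if `div u = 0` and `curl u = 0` on `ball x r` (`u` of class `C²` there) then `Δu(x) = 0`. -/
theorem laplacian_eq_zero_of_div_curl_local (hr : 0 < r) (hu : ContDiffOn ℝ 2 u (ball x r))
    (hdiv : ∀ y ∈ ball x r, VectorCalculus.divergence u y = 0) (hcurl : ∀ y ∈ ball x r, curl u y = 0) :
    Laplacian.laplacian u x = 0 := by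
  rw [laplacian_eq_neg_curl_local hr hu hdiv (w := fun _ => (0 : E3)) hcurl]
  have h0 : curl (fun _ : E3 => (0 : E3)) x = 0 := by
    rw [curl_eq_curlCLM]
    simp
  rw [h0, neg_zero]

end Summit.NavierStokesRegularity.NavierStokesRegularity.Theorems.PoloidalLiouville.AzimuthalCartan.LocalCurlCurl

end
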